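import Mathlib
import HarnessLib
import Summits.HubbardSuperconductivity.HubbardSuperconductivity.Theorems.KLProgrammeC4aAbsBubbleDirectSheet
import Summits.HubbardSuperconductivity.HubbardSuperconductivity.Theorems.KLProgrammeC4aFoldCurvaturePartnerBand

/-!
# Route `KLProgramme` — crux C4a, S3 brick (B4)/(B5) «(B4)-DIRECT-PACK», part 4: the FOLD CLASS for the actual partner band, SHEET-UNIFORM —
# near the tangency corner (`m = 0`) and near every umklapp caustic (`m ≠ 0`) the loop-angle curvature of `ē` has the floor `w·u_min²`, so
# `…C4aAbsBubbleLevelLoop.level_loop_inv_envelope_le_of_dichotomy_two` applies with FrameOK-only constants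

Cell `gate-hubbard-kl`, seat hubbard-kl-k3c3-p3 (g27; row «implicit-function / monotonicity route for μ(n)»).  Located brick for the (C)-closer lane
hubbard-kl-c4a-1 (stub (C) `stub_twoLeg_curvature` of `KLRegimeEngineV17F2`, stmt-HubbardSuperconductivity-20437), B4-ABS-BUBBLE.md §3 rows (r2)/(r3) packaged,
memo HOME/hubbard-kl-k3c3-p3/B4-DIRECT-PACK.md §4.

THE PERIOD SHIFT (row (r3) «the umklapp caustic REDUCES to (r2)», now in Lean): `e_K` is `2πℤ²`-periodic, so the partner band of the sheet `m` is the partner band of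
the SHIFTED base point `X = S − 2πm`: `e_K(S − Φ(e,x+θ)) = e_K((S − 2πm) − Φ(e,x+θ))`, and after re-centring the loop angle at a reference `x₀` (base angle
`θ* = x₀ + θ`) the general-`X` curvature comparison of `…C4aFoldCurvaturePartnerBand` (p623173, g21) applies verbatim:
* §1 `iteratedDeriv_two_partnerBand_pp_angle_eq_shift` (periodicity + `iteratedDeriv_comp_add_const`);
* §2 **`iteratedDeriv_two_partnerBand_pp_angle_ge_sheet`**: `2w·u_min² − L(‖S − 2πm − 2Φ(0,θ*)‖, |e|, |x − x₀|) ≤ ∂ₓ² e_K(S − Φ(e,x+θ))` under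
  `GeomConstants (frameLevel μ K) Kc r₀ g₀ w` (`b_T(θ*) ≥ w‖∂Φ(0,θ*)‖² ≥ w·u_min²`, `…C4aTangencyCurvatureFloor`), with p623173's explicit Lipschitz modulus `L`;
  **`abs_iteratedDeriv_two_partnerBand_pp_angle_le_sheet`**: the matching CEILING `|∂ₓ²ē| ≤ 2K₂msD₁² + L`.
* §3 **`level_loop_partnerBand_le_fold`** (FOLD CLASS ASSEMBLED, any sheet): on the loop window `[x₀ − Wφ, x₀ + Wφ]` and levels `e ∈ [lo,hi] ⊂ (0,r)` where the
  modulus stays below half the floor (`L ≤ w·u_min²`, pointwise hypothesis `hwin` — monotone in `‖S − 2πm − 2Φ(0,θ*)‖`, `hi`, `Wφ`), the curvature floor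
  `c₂ = w·u_min²` holds UNCONDITIONALLY, hence the second-order dichotomy of `level_loop_inv_envelope_le_of_dichotomy_two` for any `κ, c₁ > 0`:
  `∫_{lo..hi} w(e)·(∫ dx/max(t e,|ē|)) de ≤ W·((2(2Wφ)/κ + (4N/c₁)(1 + log⁺(κ/2/hi)))(hi − lo) + 2(12N/√c₂)√hi)` — `lo`-free; the fold's `t^{−1/2}` is integrable.
What stays located for the closer: per sheet `m` with `‖m‖_∞ ≤ 1`, that the loop angles near the `m`-th caustic fit in boundedly many such windows (for `m = 0`:
`…C4aChordMidpointDepth.torusDist_loopAngle_le_of_midpoint_near`).  Nothing about the model's sizes beyond clause (i) of `FrameOK`; nothing asserts (C), K3 or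
superconductivity.  References: Salmhofer 1999 §4.5.3 Lemma 4.10 (tangential case, Fig. 4.4) [cite: Salmhofer1999]; FST II CPAM 51 (1998) Lemma 2.1, §3
[cite: FeldmanSalmhoferTrubowitz1998]; BGM 2006 §2.4 (2.40) [cite: BenfattoGiulianiMastropietro2006].
-/

noncomputable section

namespace Summit.HubbardSuperconductivity.HubbardSuperconductivity.Theorems.C4a

set_option linter.dupNamespace false -- summit = problem name (single-conjunct summit), D-0017

open Real Set MeasureTheory
open Literature.MathematicalPhysics.QuantumLattice Literature.MathematicalPhysics.QuantumLattice.BandSectorCounting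
open Literature.MathematicalPhysics.QuantumLattice.FermiRG
open Summit.HubbardSuperconductivity.HubbardSuperconductivity.Theorems.KLRegimeSplit
open Summit.HubbardSuperconductivity.HubbardSuperconductivity.Theorems.DispersionFlow
open Summit.HubbardSuperconductivity.HubbardSuperconductivity.Theorems.PerturbedFermiCurve

/-! ## §1 The period shift and the re-centring of the loop angle -/

/-- **Period shift + re-centring**: `∂ₓ² e_K(S − Φ(e,x+θ)) = ∂_y² e_K((S − 2πm) − Φ(e, y + (x₀+θ)))|_{y = x − x₀}`. -/
theorem iteratedDeriv_two_partnerBand_pp_angle_eq_shift (μ : ℝ) (K : TrigPolyC4v) (S : Momentum) (m : Fin 2 → ℤ) (e θ x₀ x : ℝ) (n : ℕ) :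
    iteratedDeriv n (fun y : ℝ => frameLevel μ K (S - levelPoint μ K e (y + θ))) x =
      iteratedDeriv n (fun y : ℝ => frameLevel μ K (S - WithLp.toLp 2 (fun i => 2 * π * (m i : ℝ)) - levelPoint μ K e (y + (x₀ + θ)))) (x - x₀) := by
  set g : ℝ → ℝ := fun α => frameLevel μ K (S - WithLp.toLp 2 (fun i => 2 * π * (m i : ℝ)) - levelPoint μ K e α) with hg
  have h1 : (fun y : ℝ => frameLevel μ K (S - levelPoint μ K e (y + θ))) = fun y => g (y + θ) := by
    funext y
    simp only [hg]
    rw [← frameLevel_sub_twoPi μ K (S - levelPoint μ K e (y + θ)) m, sub_right_comm]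
  have h2 : (fun y : ℝ => frameLevel μ K (S - WithLp.toLp 2 (fun i => 2 * π * (m i : ℝ)) - levelPoint μ K e (y + (x₀ + θ)))) =
      fun y => g (y + (x₀ + θ)) := by
    funext y; simp only [hg]
  rw [h1, h2, iteratedDeriv_comp_add_const, iteratedDeriv_comp_add_const]
  simp only
  rw [show x - x₀ + (x₀ + θ) = x + θ by ring]

section Sizes

variable {K : TrigPolyC4v} {A : ℝ} (hA : ∀ p : Momentum, ∀ j ≤ 2, ‖iteratedFDeriv ℝ j (frameShift K) p‖ ≤ A) (hA20 : A ≤ 1 / 20)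
  (hd : klCurveD ≤ (bandBounds (show (-4 : ℝ) < -1.1 by norm_num) (show (-1.1 : ℝ) ≤ -0.1 by norm_num)
    (show (-0.1 : ℝ) < 0 by norm_num)).Dtmin - 2 * A)
  {μ r : ℝ} (hr : 0 < r) (hlo : (-1.1 : ℝ) < μ - r - A) (hhi : μ + r + A < -0.1)
  {A₃ A₄ : ℝ} (hA₃ : ∀ p : Momentum, ‖iteratedFDeriv ℝ 3 (frameShift K) p‖ ≤ A₃)
  (hA₄ : ∀ p : Momentum, ‖iteratedFDeriv ℝ 4 (frameShift K) p‖ ≤ A₄)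
  {K₁ K₂ K₃ : ℝ} (hK₁ : ∀ p : Momentum, ‖fderiv ℝ (frameLevel μ K) p‖ ≤ K₁) (hK₂ : ∀ p : Momentum, ‖iteratedFDeriv ℝ 2 (frameLevel μ K) p‖ ≤ K₂)
  (hK₃ : ∀ p : Momentum, ‖iteratedFDeriv ℝ 3 (frameLevel μ K) p‖ ≤ K₃)
include hA hA20 hd hr hlo hhi hA₃ hA₄ hK₁ hK₂ hK₃

/-! ## §2 Curvature floor and ceiling of the partner band near the caustic of ANY sheet -/

/-- **CURVATURE FLOOR NEAR THE CAUSTIC OF THE SHEET `m`** (`GeomConstants (frameLevel μ K) Kc r₀ g₀ w`; reference loop angle `x₀`, base angle `θ* = x₀ + θ`):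
`2w·u_min² − L(‖S − 2πm − 2Φ(0,θ*)‖, |e|, |x − x₀|) ≤ ∂ₓ² e_K(S − Φ(e,x+θ))`, `L` = p623173's modulus with `d = Dt−2A`, `D_j = msD A₃ A₄ j`. [cite: FeldmanSalmhoferTrubowitz1998, Lemma 2.1] -/
theorem iteratedDeriv_two_partnerBand_pp_angle_ge_sheet {Kc r₀ g₀ w : ℝ} (hG : GeomConstants (frameLevel μ K) Kc r₀ g₀ w) (S : Momentum) (m : Fin 2 → ℤ)
    {e : ℝ} (he : |e| < r) (θ x₀ x : ℝ) :
    2 * (w * (bandBounds (show (-4 : ℝ) < -1.1 by norm_num) (show (-1.1 : ℝ) ≤ -0.1 by norm_num) (show (-0.1 : ℝ) < 0 by norm_num)).umin ^ 2) -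
        (K₃ * (‖S - WithLp.toLp 2 (fun i => 2 * π * (m i : ℝ)) - (levelPoint μ K 0 (x₀ + θ) + levelPoint μ K 0 (x₀ + θ))‖ +
              |e| / ((bandBounds (show (-4 : ℝ) < -1.1 by norm_num) (show (-1.1 : ℝ) ≤ -0.1 by norm_num) (show (-0.1 : ℝ) < 0 by norm_num)).Dtmin - 2 * A) +
              msD A₃ A₄ 1 * |x - x₀|) * msD A₃ A₄ 1 ^ 2 +
          K₂ * (radialRowOneConst A ((bandBounds (show (-4 : ℝ) < -1.1 by norm_num) (show (-1.1 : ℝ) ≤ -0.1 by norm_num) (show (-0.1 : ℝ) < 0 by norm_num)).Dtmin -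
                2 * A) * |e| + msD A₃ A₄ 2 * |x - x₀|) * (msD A₃ A₄ 1 + msD A₃ A₄ 1) +
          K₂ * (‖S - WithLp.toLp 2 (fun i => 2 * π * (m i : ℝ)) - (levelPoint μ K 0 (x₀ + θ) + levelPoint μ K 0 (x₀ + θ))‖ +
              |e| / ((bandBounds (show (-4 : ℝ) < -1.1 by norm_num) (show (-1.1 : ℝ) ≤ -0.1 by norm_num) (show (-0.1 : ℝ) < 0 by norm_num)).Dtmin - 2 * A) +
              msD A₃ A₄ 1 * |x - x₀|) * msD A₃ A₄ 2 +
          K₁ * ((uRowTwoConst A A₃ ((bandBounds (show (-4 : ℝ) < -1.1 by norm_num) (show (-1.1 : ℝ) ≤ -0.1 by norm_num) (show (-0.1 : ℝ) < 0 by norm_num)).Dtmin -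
                  2 * A) +
                1 / ((bandBounds (show (-4 : ℝ) < -1.1 by norm_num) (show (-1.1 : ℝ) ≤ -0.1 by norm_num) (show (-0.1 : ℝ) < 0 by norm_num)).Dtmin - 2 * A) +
                2 * (radialRowOneConst A ((bandBounds (show (-4 : ℝ) < -1.1 by norm_num) (show (-1.1 : ℝ) ≤ -0.1 by norm_num)
                    (show (-0.1 : ℝ) < 0 by norm_num)).Dtmin - 2 * A) -
                  1 / ((bandBounds (show (-4 : ℝ) < -1.1 by norm_num) (show (-1.1 : ℝ) ≤ -0.1 by norm_num) (show (-0.1 : ℝ) < 0 by norm_num)).Dtmin - 2 * A))) *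
              |e| + msD A₃ A₄ 3 * |x - x₀|)) ≤
      iteratedDeriv 2 (fun y : ℝ => frameLevel μ K (S - levelPoint μ K e (y + θ))) x := by
  have h0 : |(0 : ℝ)| < r := by simpa using hr
  rw [iteratedDeriv_two_partnerBand_pp_angle_eq_shift μ K S m e θ x₀ x 2]
  have hmain := abs_iteratedDeriv_two_partnerBand_angle_sub_two_curv_le hA hA20 hd hr hlo hhi hA₃ hA₄ hK₁ hK₂ hK₃
    (S - WithLp.toLp 2 (fun i => 2 * π * (m i : ℝ))) he (x₀ + θ) (x - x₀)
  -- the floor of the reference curvature `b_T(θ*)`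
  have hb := curvCoeff_ge_of_geomConstants hA hd hr hlo hhi hG (x₀ + θ)
  have hu := umin_le_norm_iteratedDeriv_one_levelPoint hA hd hlo hhi h0 (x₀ + θ)
  have hupos := (bandBounds (show (-4 : ℝ) < -1.1 by norm_num) (show (-1.1 : ℝ) ≤ -0.1 by norm_num) (show (-0.1 : ℝ) < 0 by norm_num)).umin_pos
  have hw := hG.wmin_pos
  have hsq : w * (bandBounds (show (-4 : ℝ) < -1.1 by norm_num) (show (-1.1 : ℝ) ≤ -0.1 by norm_num) (show (-0.1 : ℝ) < 0 by norm_num)).umin ^ 2 ≤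
      w * ‖iteratedDeriv 1 (levelPoint μ K 0) (x₀ + θ)‖ ^ 2 := by
    gcongr
  have habs := (abs_le.1 hmain).1
  linarith

/-- **CURVATURE CEILING**: `|∂ₓ² e_K(S − Φ(e,x+θ))| ≤ 2K₂·msD₁² + L` (same `L`; `|b_T(θ*)| ≤ K₂·‖∂Φ(0,θ*)‖² ≤ K₂·msD₁²`). -/
theorem abs_iteratedDeriv_two_partnerBand_pp_angle_le_sheet (S : Momentum) (m : Fin 2 → ℤ) {e : ℝ} (he : |e| < r) (θ x₀ x : ℝ) :
    |iteratedDeriv 2 (fun y : ℝ => frameLevel μ K (S - levelPoint μ K e (y + θ))) x| ≤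
      2 * (K₂ * msD A₃ A₄ 1 ^ 2) +
        (K₃ * (‖S - WithLp.toLp 2 (fun i => 2 * π * (m i : ℝ)) - (levelPoint μ K 0 (x₀ + θ) + levelPoint μ K 0 (x₀ + θ))‖ +
              |e| / ((bandBounds (show (-4 : ℝ) < -1.1 by norm_num) (show (-1.1 : ℝ) ≤ -0.1 by norm_num) (show (-0.1 : ℝ) < 0 by norm_num)).Dtmin - 2 * A) +
              msD A₃ A₄ 1 * |x - x₀|) * msD A₃ A₄ 1 ^ 2 +
          K₂ * (radialRowOneConst A ((bandBounds (show (-4 : ℝ) < -1.1 by norm_num) (show (-1.1 : ℝ) ≤ -0.1 by norm_num) (show (-0.1 : ℝ) < 0 by norm_num)).Dtmin -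
                2 * A) * |e| + msD A₃ A₄ 2 * |x - x₀|) * (msD A₃ A₄ 1 + msD A₃ A₄ 1) +
          K₂ * (‖S - WithLp.toLp 2 (fun i => 2 * π * (m i : ℝ)) - (levelPoint μ K 0 (x₀ + θ) + levelPoint μ K 0 (x₀ + θ))‖ +
              |e| / ((bandBounds (show (-4 : ℝ) < -1.1 by norm_num) (show (-1.1 : ℝ) ≤ -0.1 by norm_num) (show (-0.1 : ℝ) < 0 by norm_num)).Dtmin - 2 * A) +
              msD A₃ A₄ 1 * |x - x₀|) * msD A₃ A₄ 2 +
          K₁ * ((uRowTwoConst A A₃ ((bandBounds (show (-4 : ℝ) < -1.1 by norm_num) (show (-1.1 : ℝ) ≤ -0.1 by norm_num) (show (-0.1 : ℝ) < 0 by norm_num)).Dtmin -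
                  2 * A) +
                1 / ((bandBounds (show (-4 : ℝ) < -1.1 by norm_num) (show (-1.1 : ℝ) ≤ -0.1 by norm_num) (show (-0.1 : ℝ) < 0 by norm_num)).Dtmin - 2 * A) +
                2 * (radialRowOneConst A ((bandBounds (show (-4 : ℝ) < -1.1 by norm_num) (show (-1.1 : ℝ) ≤ -0.1 by norm_num)
                    (show (-0.1 : ℝ) < 0 by norm_num)).Dtmin - 2 * A) -
                  1 / ((bandBounds (show (-4 : ℝ) < -1.1 by norm_num) (show (-1.1 : ℝ) ≤ -0.1 by norm_num) (show (-0.1 : ℝ) < 0 by norm_num)).Dtmin - 2 * A))) *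
              |e| + msD A₃ A₄ 3 * |x - x₀|)) := by
  have h0 : |(0 : ℝ)| < r := by simpa using hr
  rw [iteratedDeriv_two_partnerBand_pp_angle_eq_shift μ K S m e θ x₀ x 2]
  have hmain := abs_iteratedDeriv_two_partnerBand_angle_sub_two_curv_le hA hA20 hd hr hlo hhi hA₃ hA₄ hK₁ hK₂ hK₃
    (S - WithLp.toLp 2 (fun i => 2 * π * (m i : ℝ))) he (x₀ + θ) (x - x₀)
  -- `|b_T(θ*)| ≤ K₂·D₁²`
  set v : Momentum := iteratedDeriv 1 (levelPoint μ K 0) (x₀ + θ) with hv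
  have hD1 : ‖v‖ ≤ msD A₃ A₄ 1 := norm_iteratedDeriv_levelPoint_le hA hA20 hd hlo hhi hA₃ hA₄ h0 le_rfl (by norm_num) _
  have hbT : |fderiv ℝ (fderiv ℝ (frameLevel μ K)) (levelPoint μ K 0 (x₀ + θ)) v v| ≤ K₂ * msD A₃ A₄ 1 ^ 2 := by
    rw [← Real.norm_eq_abs]
    have h1 : ‖fderiv ℝ (fderiv ℝ (frameLevel μ K)) (levelPoint μ K 0 (x₀ + θ)) v v‖ ≤
        ‖fderiv ℝ (fderiv ℝ (frameLevel μ K)) (levelPoint μ K 0 (x₀ + θ))‖ * ‖v‖ * ‖v‖ := ContinuousLinearMap.le_opNorm₂ _ _ _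
    have h2 : ‖fderiv ℝ (fderiv ℝ (frameLevel μ K)) (levelPoint μ K 0 (x₀ + θ))‖ ≤ K₂ := by
      rw [norm_fderiv_two_eq_norm_iteratedFDeriv]; exact hK₂ _
    have hK₂0 : 0 ≤ K₂ := (norm_nonneg _).trans (hK₂ 0)
    have hM0 : 0 ≤ msD A₃ A₄ 1 := (norm_nonneg _).trans hD1
    calc _ ≤ ‖fderiv ℝ (fderiv ℝ (frameLevel μ K)) (levelPoint μ K 0 (x₀ + θ))‖ * ‖v‖ * ‖v‖ := h1
      _ ≤ K₂ * msD A₃ A₄ 1 * msD A₃ A₄ 1 := by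
          have := norm_nonneg v
          exact mul_le_mul (mul_le_mul h2 hD1 this hK₂0) hD1 this (mul_nonneg hK₂0 hM0)
      _ = K₂ * msD A₃ A₄ 1 ^ 2 := by ring
  have habs := abs_le.1 hmain
  have hb := abs_le.1 hbT
  rw [abs_le]
  constructor <;> linarith [habs.1, habs.2, hb.1, hb.2]

/-! ## §3 FOLD CLASS for the partner band near the caustic of any sheet, ASSEMBLED -/

/-- **THE ABSOLUTE BUBBLE OVER A FOLD WINDOW IS `n`-FREE** (partner band; tangency corner `m = 0`, umklapp caustics `m ≠ 0`; FrameOK-only constants).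
Configuration `(ρ,ϑ,θ)` (`S` its pair sum), sheet `m`, reference loop angle `x₀`, window `[x₀ − Wφ, x₀ + Wφ]`, levels `e ∈ [lo,hi]`, `0 < lo ≤ hi < r`; the
window hypothesis `hwin`: p623173's modulus `L(‖S − 2πm − 2Φ(0,x₀+θ)‖, |e|, |x − x₀|) ≤ w·u_min²` at every `(e, x)` of the window (it is monotone in its three
arguments, so it is ONE inequality at `(hi, Wφ)`); free first-order parameters `κ, c₁ > 0` and cells `N` with `(2Wφ)·2K₁msD₁ ≤ Nκ`, `(2Wφ)·4(2K₂msD₁² + w·u_min²) ≤ Nc₁`;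
envelope floors `t e ≥ e`, weight `0 ≤ w ≤ W`.  THEN, with `c₂ = w·u_min²`,
`∫_{lo..hi} w(e)·(∫_{window} dx/max(t e, |e_K(S − Φ(e,x+θ))|)) de ≤ W·((2(2Wφ)/κ + (4N/c₁)(1 + log⁺(κ/2/hi)))(hi − lo) + 2·(12N/√c₂)·√hi)`.
[cite: Salmhofer1999, §4.5.3 Lemma 4.10; FeldmanSalmhoferTrubowitz1998, §3] -/
theorem level_loop_partnerBand_le_fold {Kc r₀ g₀ w : ℝ} (hG : GeomConstants (frameLevel μ K) Kc r₀ g₀ w)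
    (hK₁0 : 0 < K₁) {ρ ϑ θ x₀ Wφ lo hi κ c₁ W : ℝ} {m : Fin 2 → ℤ} {t wt : ℝ → ℝ} {N : ℕ}
    (hWφ : 0 ≤ Wφ) (hlo0 : 0 < lo) (hlohi : lo ≤ hi) (hhir : hi < r) (hκ : 0 < κ) (hc₁ : 0 < c₁)
    (hwin : ∀ e ∈ Icc lo hi, ∀ x ∈ Icc (x₀ - Wφ) (x₀ + Wφ),
        K₃ * (‖pairSumPath μ K ρ ϑ θ 0 - WithLp.toLp 2 (fun i => 2 * π * (m i : ℝ)) - (levelPoint μ K 0 (x₀ + θ) + levelPoint μ K 0 (x₀ + θ))‖ +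
              |e| / ((bandBounds (show (-4 : ℝ) < -1.1 by norm_num) (show (-1.1 : ℝ) ≤ -0.1 by norm_num) (show (-0.1 : ℝ) < 0 by norm_num)).Dtmin - 2 * A) +
              msD A₃ A₄ 1 * |x - x₀|) * msD A₃ A₄ 1 ^ 2 +
          K₂ * (radialRowOneConst A ((bandBounds (show (-4 : ℝ) < -1.1 by norm_num) (show (-1.1 : ℝ) ≤ -0.1 by norm_num) (show (-0.1 : ℝ) < 0 by norm_num)).Dtmin -
                2 * A) * |e| + msD A₃ A₄ 2 * |x - x₀|) * (msD A₃ A₄ 1 + msD A₃ A₄ 1) +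
          K₂ * (‖pairSumPath μ K ρ ϑ θ 0 - WithLp.toLp 2 (fun i => 2 * π * (m i : ℝ)) - (levelPoint μ K 0 (x₀ + θ) + levelPoint μ K 0 (x₀ + θ))‖ +
              |e| / ((bandBounds (show (-4 : ℝ) < -1.1 by norm_num) (show (-1.1 : ℝ) ≤ -0.1 by norm_num) (show (-0.1 : ℝ) < 0 by norm_num)).Dtmin - 2 * A) +
              msD A₃ A₄ 1 * |x - x₀|) * msD A₃ A₄ 2 +
          K₁ * ((uRowTwoConst A A₃ ((bandBounds (show (-4 : ℝ) < -1.1 by norm_num) (show (-1.1 : ℝ) ≤ -0.1 by norm_num) (show (-0.1 : ℝ) < 0 by norm_num)).Dtmin -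
                  2 * A) +
                1 / ((bandBounds (show (-4 : ℝ) < -1.1 by norm_num) (show (-1.1 : ℝ) ≤ -0.1 by norm_num) (show (-0.1 : ℝ) < 0 by norm_num)).Dtmin - 2 * A) +
                2 * (radialRowOneConst A ((bandBounds (show (-4 : ℝ) < -1.1 by norm_num) (show (-1.1 : ℝ) ≤ -0.1 by norm_num)
                    (show (-0.1 : ℝ) < 0 by norm_num)).Dtmin - 2 * A) -
                  1 / ((bandBounds (show (-4 : ℝ) < -1.1 by norm_num) (show (-1.1 : ℝ) ≤ -0.1 by norm_num) (show (-0.1 : ℝ) < 0 by norm_num)).Dtmin - 2 * A))) *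
              |e| + msD A₃ A₄ 3 * |x - x₀|) ≤
        w * (bandBounds (show (-4 : ℝ) < -1.1 by norm_num) (show (-1.1 : ℝ) ≤ -0.1 by norm_num) (show (-0.1 : ℝ) < 0 by norm_num)).umin ^ 2)
    (hN : (x₀ + Wφ - (x₀ - Wφ)) * (2 * (K₁ * msD A₃ A₄ 1)) ≤ N * κ)
    (hN' : (x₀ + Wφ - (x₀ - Wφ)) * (4 * (2 * (K₂ * msD A₃ A₄ 1 ^ 2) +
        w * (bandBounds (show (-4 : ℝ) < -1.1 by norm_num) (show (-1.1 : ℝ) ≤ -0.1 by norm_num) (show (-0.1 : ℝ) < 0 by norm_num)).umin ^ 2)) ≤ N * c₁)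
    (ht : ∀ e ∈ Icc lo hi, e ≤ t e) (hW : 0 ≤ W) (hw0 : ∀ e ∈ Icc lo hi, 0 ≤ wt e) (hw : ∀ e ∈ Icc lo hi, wt e ≤ W) :
    ∫ e in lo..hi, wt e * ∫ x in Icc (x₀ - Wφ) (x₀ + Wφ), (max (t e) |frameLevel μ K (pairSumPath μ K ρ ϑ θ 0 - levelPoint μ K e (x + θ))|)⁻¹ ≤
      W * ((2 * (x₀ + Wφ - (x₀ - Wφ)) / κ + N * (4 / c₁) * (1 + log⁺ (κ / 2 / hi))) * (hi - lo) +
        2 * (12 * N / Real.sqrt (w * (bandBounds (show (-4 : ℝ) < -1.1 by norm_num) (show (-1.1 : ℝ) ≤ -0.1 by norm_num)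
          (show (-0.1 : ℝ) < 0 by norm_num)).umin ^ 2)) * Real.sqrt hi) := by
  have hM := msD_one_pos A₃ A₄
  have hupos := (bandBounds (show (-4 : ℝ) < -1.1 by norm_num) (show (-1.1 : ℝ) ≤ -0.1 by norm_num) (show (-0.1 : ℝ) < 0 by norm_num)).umin_pos
  have hwpos := hG.wmin_pos
  have hK₂0 : 0 ≤ K₂ := (norm_nonneg _).trans (hK₂ 0)
  have hc₂ : 0 < w * (bandBounds (show (-4 : ℝ) < -1.1 by norm_num) (show (-1.1 : ℝ) ≤ -0.1 by norm_num) (show (-0.1 : ℝ) < 0 by norm_num)).umin ^ 2 := by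
    positivity
  have heI : ∀ e ∈ Icc lo hi, |e| < r := fun e he => by
    rw [abs_of_pos (hlo0.trans_le he.1)]; exact lt_of_le_of_lt he.2 hhir
  refine level_loop_inv_envelope_le_of_dichotomy_two (G := fun e x => frameLevel μ K (pairSumPath μ K ρ ϑ θ 0 - levelPoint μ K e (x + θ)))
    (by linarith) hlo0 hlohi (fun e he => contDiff_partnerBand_pp_angle hA hd hlo hhi ρ (heI e he) ϑ θ 2) hκ hc₁ hc₂ (mul_pos hK₁0 hM)
    (by positivity) (fun e he x _ => abs_deriv_partnerBand_pp_angle_le hA hA20 hd hlo hhi hA₃ hA₄ hK₁ ρ (heI e he) ϑ θ x)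
    (fun e he x hx => ?_) (fun e he x hx _ _ => ?_) hN hN' ht hW hw0 hw
  · -- ceiling
    have h := abs_iteratedDeriv_two_partnerBand_pp_angle_le_sheet hA hA20 hd hr hlo hhi hA₃ hA₄ hK₁ hK₂ hK₃ (pairSumPath μ K ρ ϑ θ 0) m (heI e he) θ x₀ x
    have hw' := hwin e he x hx
    linarith
  · -- floor (the dichotomy antecedents are not needed)
    have h := iteratedDeriv_two_partnerBand_pp_angle_ge_sheet hA hA20 hd hr hlo hhi hA₃ hA₄ hK₁ hK₂ hK₃ hG (pairSumPath μ K ρ ϑ θ 0) m (heI e he) θ x₀ x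
    have hw' := hwin e he x hx
    exact le_trans (by linarith) (le_abs_self _)

end Sizes

end Summit.HubbardSuperconductivity.HubbardSuperconductivity.Theorems.C4a

end
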